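import Summits.ResolutionOfSingularities.ResolutionOfSingularities.Theorems.MarkedTransferCampaignW46MohWindowShadeTruncation
import Mathlib.RingTheory.MvPowerSeries.Order
import HarnessLib

/-!
# [OURS · L1 W4.6] Rung (iii) "Moh window": the classical (order, shade) model for POWER-SERIES residuals —
  states, the step by truncation transfer, and the agreement calculus (definitions + transfer lemmas)

Cell `res-hironaka`, rung L, slot W4.6, seat `res-L1-s46-pv-6` (gen 6).  `--supports
stmt-ResolutionOfSingularities-16155 --as helper`.  Everything here is OURS model vocabulary; NOT a statement of
the manuscript [claim: Hironaka2017, status: under-review], nothing of which is used.  AI review is weaker than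
expert review.

## What
The polynomial model of `Literature.AlgebraicGeometry.Resolution.PointBlowup` (states `(F, r)`, `F ∈ K[y]` the
residual polynomial of `x^q + F(y)`, `step q j b` = chart transform ∘ translation ∘ cleaning, shade
`ord₀ F − |r|`) is extended to residual POWER SERIES `F ∈ K⟦y⟧` WITHOUT re-proving its algebra: in the
Hauser–Wagner frame (`b_j = 0` in the chart `y_j`) the coefficient of `y^E` of the transform reads only the
monomials of `F` of total degree `≤ E_j + q` (`coeff_step_F_eq_of_forall`, LOCALITY), so the power-series step is
DEFINED coefficientwise from the polynomial step applied to a deep enough total-degree truncation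
(`Series.step`), and every polynomial statement about one step transfers through the AGREEMENT relation
`Agree M s S` («the polynomial state `s` and the series state `S` have the same multiplicities and the same
coefficients below total degree `M`»): `Agree M s S → Agree (M − q) (step s) (S.step)` (`Agree.step`), orders /
shades / equimultiplicity / support membership are read faithfully below `M` (`Agree.ordZero_eq`, `Agree.shade_eq`,
`Agree.isEquimultiplePoint_iff`).  This is the infrastructure of the power-series port asked for in
HOME/L/res-L1-s46-pv-6/GENERAL-REGIME-ANALYSIS.md §2/§6(d) (the residual series of a purely inseparable surface
germ `z^p + F(x, y)` is a power series, not a polynomial, in general).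

## Not here
The per-step laws (no-increase, adapted states, Hasse test, terminal case) for series, the finite-horizon run
formula and the walk-level termination theorem: companion files `…MohWindowShadePS*.lean`.
-/

noncomputable section

set_option linter.dupNamespace false -- mandated namespace of this single-conjunct summit

open MvPolynomial Finset

namespace Summit.ResolutionOfSingularities.ResolutionOfSingularities.Theorems.CampaignW46.MohWindowShadePS

open Literature.AlgebraicGeometry.Resolution
open Literature.AlgebraicGeometry.Resolution.PointBlowup
open Literature.AlgebraicGeometry.Resolution.Hauser2010
open Literature.Barriers.ResolutionOfSingularities (ordZero_le_of_coeff_ne_zero le_ordZero_of_forall)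

variable {σ : Type*} {K : Type*} [Field K]

/-! ## §1 Total-degree truncation -/

section Trunc

variable [Fintype σ] [DecidableEq σ]

/-- The truncation `Σ_{|d| < N} coeff_d(φ)·y^d ∈ K[y]` of a power series `φ ∈ K⟦y⟧` below total degree `N`
(the finite sum of `…MohWindowShadeTruncation`). [folklore] -/
def truncTot (N : ℕ) (φ : MvPowerSeries σ K) : MvPolynomial σ K :=
  ∑ d ∈ (Finset.Iic (Finsupp.equivFunOnFinite.symm fun _ : σ => N)).filter (fun d => d.degree < N),
    monomial d (MvPowerSeries.coeff d φ)

/-- Coefficients of the truncation: those of `φ` below degree `N`, zero from degree `N` on. [folklore] -/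
theorem coeff_truncTot (N : ℕ) (φ : MvPowerSeries σ K) (e : σ →₀ ℕ) :
    coeff e (truncTot N φ) = if e.degree < N then MvPowerSeries.coeff e φ else 0 :=
  MohWindowShadeTruncation.coeff_truncSum φ N e

/-- A monomial of the truncation has degree `< N`. [folklore] -/
theorem degree_lt_of_mem_support_truncTot {N : ℕ} {φ : MvPowerSeries σ K} {e : σ →₀ ℕ}
    (he : e ∈ (truncTot N φ).support) : e.degree < N := by
  by_contra h
  rw [MvPolynomial.mem_support_iff, coeff_truncTot, if_neg h] at he
  exact he rfl

end Trunc

/-! ## §2 Series states, shade, agreement -/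

/-- A **series state** of the walk: the residual power series `F ∈ K⟦y⟧` of `x^q + F(y)` together with the
exceptional multiplicities `r` (`D = {y^r = 0}`) — the power-series twin of `PointBlowup.State`. [folklore] -/
structure Series (σ : Type*) (K : Type*) [Field K] where
  /-- the residual power series `F(y)` of `x^q + F(y)` -/
  F : MvPowerSeries σ K
  /-- the exceptional multiplicities `r`, `D = {y^r = 0}` -/
  r : σ →₀ ℕ

namespace Series

/-- The polynomial state obtained by truncating the residual series below total degree `N`. [folklore] -/
def trunc [Fintype σ] [DecidableEq σ] (N : ℕ) (S : Series σ K) : State σ K := ⟨truncTot N S.F, S.r⟩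

/-- The **shade** of a series state: `ord F − |r|` in `ℕ∞` (`PointBlowup.State.shade` for series). [folklore] -/
def shade (S : Series σ K) : ℕ∞ := S.F.order - (S.r.degree : ℕ∞)

/-- `trunc` keeps the multiplicities. [folklore] -/
@[simp] theorem trunc_r [Fintype σ] [DecidableEq σ] (N : ℕ) (S : Series σ K) : (S.trunc N).r = S.r := rfl

/-- `trunc` truncates the residual series. [folklore] -/
@[simp] theorem trunc_F [Fintype σ] [DecidableEq σ] (N : ℕ) (S : Series σ K) : (S.trunc N).F = truncTot N S.F := rfl

/-- The shade of a series state whose residual series has order `o`. [folklore] -/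
theorem shade_eq_of_order_eq (S : Series σ K) {o : ℕ} (ho : S.F.order = o) :
    S.shade = ((o - S.r.degree : ℕ) : ℕ∞) := by
  unfold shade
  rw [ho]
  exact (ENat.coe_sub _ _).symm

end Series

/-- **Agreement below degree `M`**: the polynomial state `s` and the series state `S` have the same
multiplicities and the same coefficients in all total degrees `< M`. [folklore] -/
def Agree (M : ℕ) (s : State σ K) (S : Series σ K) : Prop :=
  (∀ e : σ →₀ ℕ, e.degree < M → coeff e s.F = MvPowerSeries.coeff e S.F) ∧ s.r = S.r

/-- The truncation below `N` agrees with the series below `N`. [folklore] -/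
theorem agree_trunc [Fintype σ] [DecidableEq σ] (N : ℕ) (S : Series σ K) : Agree N (S.trunc N) S :=
  ⟨fun e he => by rw [Series.trunc_F, coeff_truncTot, if_pos he], rfl⟩

/-- Agreement is inherited below. [folklore] -/
theorem Agree.mono {M M' : ℕ} (hM : M' ≤ M) {s : State σ K} {S : Series σ K} (h : Agree M s S) :
    Agree M' s S :=
  ⟨fun e he => h.1 e (lt_of_lt_of_le he hM), h.2⟩

/-- Under agreement below `M`, an order `< M` of the series is the order of the polynomial. [folklore] -/
theorem Agree.ordZero_eq {M : ℕ} {s : State σ K} {S : Series σ K} (h : Agree M s S) {o : ℕ}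
    (ho : S.F.order = o) (hoM : o < M) : ordZero s.F = o := by
  rw [ordZero_eq_nat_iff]
  obtain ⟨⟨d, hd, hdeg⟩, hmin⟩ := MvPowerSeries.order_eq_nat.mp ho
  refine ⟨⟨d, ?_, hdeg⟩, fun d' hd' => ?_⟩
  · rwa [h.1 d (by rw [hdeg]; exact hoM)]
  · rw [h.1 d' (lt_trans hd' hoM)]; exact hmin d' hd'

/-- Under agreement below `M`, an order `< M` of the polynomial is the order of the series. [folklore] -/
theorem Agree.order_eq {M : ℕ} {s : State σ K} {S : Series σ K} (h : Agree M s S) {o : ℕ}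
    (ho : ordZero s.F = o) (hoM : o < M) : S.F.order = o := by
  rw [MvPowerSeries.order_eq_nat]
  obtain ⟨⟨d, hd, hdeg⟩, hmin⟩ := (ordZero_eq_nat_iff _ _).mp ho
  refine ⟨⟨d, ?_, hdeg⟩, fun d' hd' => ?_⟩
  · rwa [← h.1 d (by rw [hdeg]; exact hoM)]
  · rw [← h.1 d' (lt_trans hd' hoM)]; exact hmin d' hd'

/-- Under agreement below `M`, if the polynomial has order `≥ M` (or is zero) then so has the series: precisely,
`M ≤ ordZero s.F → M ≤ S.F.order`. [folklore] -/
theorem Agree.le_order {M : ℕ} {s : State σ K} {S : Series σ K} (h : Agree M s S)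
    (hM : (M : ℕ∞) ≤ ordZero s.F) : (M : ℕ∞) ≤ S.F.order := by
  refine MvPowerSeries.nat_le_order fun d hd => ?_
  rw [← h.1 d (by exact_mod_cast hd)]
  by_contra hne
  exact absurd (lt_of_lt_of_le (by exact_mod_cast hd : (d.degree : ℕ∞) < M) hM)
    (not_lt.mpr (ordZero_le_of_coeff_ne_zero _ _ hne))

/-- Under agreement below `M`, `M ≤ S.F.order → M ≤ ordZero s.F`. [folklore] -/
theorem Agree.le_ordZero {M : ℕ} {s : State σ K} {S : Series σ K} (h : Agree M s S)
    (hM : (M : ℕ∞) ≤ S.F.order) : (M : ℕ∞) ≤ ordZero s.F := by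
  refine le_ordZero_of_forall _ _ fun d hd => ?_
  by_contra hlt
  push Not at hlt
  apply hd
  rw [h.1 d hlt]
  exact MvPowerSeries.coeff_of_lt_order (lt_of_lt_of_le (by exact_mod_cast hlt) hM)

/-- Under agreement below `M`, a series of order `o < M` and the polynomial have the same shade. [folklore] -/
theorem Agree.shade_eq {M : ℕ} {s : State σ K} {S : Series σ K} (h : Agree M s S) {o : ℕ}
    (ho : S.F.order = o) (hoM : o < M) : s.shade = S.shade := by
  rw [shade_eq_of_ordZero_eq s (h.ordZero_eq ho hoM), S.shade_eq_of_order_eq ho, h.2]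

/-- Under agreement below `M`, support membership of a monomial of degree `< M` is read on either side. [folklore] -/
theorem Agree.mem_support_iff {M : ℕ} {s : State σ K} {S : Series σ K} (h : Agree M s S) {e : σ →₀ ℕ}
    (he : e.degree < M) : e ∈ s.F.support ↔ MvPowerSeries.coeff e S.F ≠ 0 := by
  rw [MvPolynomial.mem_support_iff, h.1 e he]

/-! ## §3 Locality of the polynomial step in the Hauser–Wagner frame -/

/-- In the chart `y_j` at a point with `b_j = 0`, the translated chart transform of a monomial `y^d` has all its
monomials with `y_j`-exponent `|d| ∸ q`: its coefficient of `y^E` vanishes unless `E_j = |d| ∸ q`. [folklore] -/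
theorem coeff_translate_monomial_chartExponent_eq_zero [Fintype σ] [DecidableEq σ] (q : ℕ) (j : σ) (b : σ → K) (hbj : b j = 0)
    (d E : σ →₀ ℕ) (a : K) (hE : E j ≠ d.degree - q) :
    coeff E (translate b (monomial (chartExponent q j d) a)) = 0 := by
  rcases Nat.lt_or_gt_of_ne hE with h | h
  · exact WeightedBlowup.coeff_translate_monomial_eq_zero_of_apply_eq_zero b _ E a hbj
      (by rw [chartExponent_apply, if_pos rfl]; exact h)
  · exact WeightedBlowup.coeff_translate_monomial_eq_zero_of_lt b _ E a
      (by rw [chartExponent_apply, if_pos rfl]; exact h)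

/-- **LOCALITY of the translated chart transform.**  At a point with `b_j = 0` of the chart `y_j`, the coefficient
of `y^E` of `pointTransform q j b s` depends only on the coefficients of `s.F` in total degrees `≤ E_j + q`.
[folklore] -/
theorem coeff_pointTransform_eq_of_forall [Fintype σ] [DecidableEq σ] (q : ℕ) (j : σ) (b : σ → K) (hbj : b j = 0) {s s' : State σ K}
    {E : σ →₀ ℕ} (h : ∀ d : σ →₀ ℕ, d.degree ≤ E j + q → coeff d s.F = coeff d s'.F) :
    coeff E (pointTransform q j b s) = coeff E (pointTransform q j b s') := by
  classical
  -- both sides as sums over the union of the supports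
  have key : ∀ (t : State σ K) (T : Finset (σ →₀ ℕ)), t.F.support ⊆ T →
      coeff E (pointTransform q j b t) =
        ∑ d ∈ T, coeff E (translate b (monomial (chartExponent q j d) (coeff d t.F))) := by
    intro t T hT
    rw [pointTransform_eq_sum, coeff_sum]
    refine Finset.sum_subset hT fun d _ hd => ?_
    simp only [MvPolynomial.notMem_support_iff.mp hd, translate, map_zero, coeff_zero]
  rw [key s (s.F.support ∪ s'.F.support) Finset.subset_union_left,
    key s' (s.F.support ∪ s'.F.support) Finset.subset_union_right]
  refine Finset.sum_congr rfl fun d _ => ?_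
  by_cases hd : d.degree ≤ E j + q
  · rw [h d hd]
  · have hne : E j ≠ d.degree - q := by omega
    rw [coeff_translate_monomial_chartExponent_eq_zero q j b hbj d E _ hne,
      coeff_translate_monomial_chartExponent_eq_zero q j b hbj d E _ hne]

/-- **LOCALITY of the step.**  At a point with `b_j = 0` of the chart `y_j`, the coefficient of `y^E` of the new
residual polynomial `(step q j b s).F` depends only on the coefficients of `s.F` in total degrees `≤ E_j + q`.
[folklore] -/
theorem coeff_step_F_eq_of_forall [Fintype σ] [DecidableEq σ] [DecidableEq K] (q : ℕ) (j : σ) (b : σ → K) (hbj : b j = 0) {s s' : State σ K}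
    {E : σ →₀ ℕ} (h : ∀ d : σ →₀ ℕ, d.degree ≤ E j + q → coeff d s.F = coeff d s'.F) :
    coeff E (step q j b s).F = coeff E (step q j b s').F := by
  show coeff E (deletePthPowers q (pointTransform q j b s)) = coeff E (deletePthPowers q (pointTransform q j b s'))
  rw [coeff_deletePthPowers, coeff_deletePthPowers, coeff_pointTransform_eq_of_forall q j b hbj h]

/-! ## §4 The series step -/

namespace Series

section Defs

variable [Fintype σ] [DecidableEq σ] (q : ℕ) (j : σ) (b : σ → K)

/-- The **translated chart transform of a series state** at the point `b` (`b_j = 0`) of the chart `y_j`,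
coefficientwise: the coefficient of `y^E` is that of the polynomial `pointTransform` of the truncation below degree
`E_j + q + 1` (any deeper truncation gives the same value, `coeff_pointTransform`). [folklore] -/
def pointTransform (S : Series σ K) : MvPowerSeries σ K :=
  fun E => coeff E (PointBlowup.pointTransform q j b (S.trunc (E j + q + 1)))

/-- **Equimultiple point** for a series state: the transform minus its constant term has order `≥ q`
(`PointBlowup.IsEquimultiplePoint` for series). [folklore] -/
def IsEquimultiplePoint (S : Series σ K) : Prop :=
  ∀ d : σ →₀ ℕ, d ≠ 0 → d.degree < q → MvPowerSeries.coeff d (S.pointTransform q j b) = 0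

/-- The **new multiplicities** of a series state (`PointBlowup.newMult` with the power-series order). [folklore] -/
def newMult [DecidableEq K] (S : Series σ K) : σ →₀ ℕ :=
  (S.r.filter fun i => b i = 0).update j (S.F.order.toNat - q)

/-- One **step** of the walk on series states at the point `b` (`b_j = 0`) of the chart `y_j`: the new residual
SERIES, coefficientwise the polynomial step of a deep enough truncation (chart transform, translation, cleaning),
and the new multiplicities. [folklore] -/
def step [DecidableEq K] (S : Series σ K) : Series σ K where
  F := fun E => coeff E (PointBlowup.step q j b (S.trunc (E j + q + 1))).F
  r := S.newMult q j b

/-- The shade **drops** at the point (series states). [folklore] -/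
def ShadeDrops [DecidableEq K] (S : Series σ K) : Prop := (S.step q j b).shade < S.shade

variable {q j b}

/-- The series transform, read on ANY polynomial state agreeing with the series in degrees `≤ E_j + q`. [folklore] -/
theorem coeff_pointTransform (hbj : b j = 0) (S : Series σ K) (E : σ →₀ ℕ) {s : State σ K}
    (h : ∀ d : σ →₀ ℕ, d.degree ≤ E j + q → coeff d s.F = MvPowerSeries.coeff d S.F) :
    MvPowerSeries.coeff E (S.pointTransform q j b) = coeff E (PointBlowup.pointTransform q j b s) := by
  rw [MvPowerSeries.coeff_apply]
  show coeff E (PointBlowup.pointTransform q j b (S.trunc (E j + q + 1))) = _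
  refine coeff_pointTransform_eq_of_forall q j b hbj fun d hd => ?_
  rw [trunc_F, coeff_truncTot, if_pos (by omega), h d hd]

/-- The series step, read on ANY polynomial state agreeing with the series in degrees `≤ E_j + q`. [folklore] -/
theorem coeff_step_F [DecidableEq K] (hbj : b j = 0) (S : Series σ K) (E : σ →₀ ℕ) {s : State σ K}
    (h : ∀ d : σ →₀ ℕ, d.degree ≤ E j + q → coeff d s.F = MvPowerSeries.coeff d S.F) :
    MvPowerSeries.coeff E (S.step q j b).F = coeff E (PointBlowup.step q j b s).F := by
  rw [MvPowerSeries.coeff_apply]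
  show coeff E (PointBlowup.step q j b (S.trunc (E j + q + 1))).F = _
  refine coeff_step_F_eq_of_forall q j b hbj fun d hd => ?_
  rw [trunc_F, coeff_truncTot, if_pos (by omega), h d hd]

/-- The new multiplicities of the series step. [folklore] -/
@[simp] theorem step_r [DecidableEq K] (S : Series σ K) : (S.step q j b).r = S.newMult q j b := rfl

omit [Fintype σ] in
/-- The new multiplicities, rewritten: `r' = (r.update j (o − q)).filter {b = 0}`. [folklore] -/
theorem newMult_eq [DecidableEq K] (hbj : b j = 0) (S : Series σ K) {o : ℕ} (ho : S.F.order = o) :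
    S.newMult q j b = (S.r.update j (o - q)).filter (fun i => b i = 0) := by
  unfold newMult
  rw [filter_update_of_pos S.r (Z := fun i => b i = 0) hbj, ho, ENat.toNat_coe]

/-- The new multiplicities, pointwise: `r'_k = (if b_k = 0 then (if k = j then o − q else r_k) else 0)`.
[folklore] -/
theorem step_r_apply [DecidableEq K] (hbj : b j = 0) (S : Series σ K) {o : ℕ} (ho : S.F.order = o) (k : σ) :
    (S.step q j b).r k = if b k = 0 then (if k = j then o - q else S.r k) else 0 := by
  rw [step_r, S.newMult_eq hbj ho, Finsupp.filter_apply, Finsupp.update_apply]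

/-- The series step and the polynomial step have the same multiplicities when the orders agree. [folklore] -/
theorem step_r_eq_of_ordZero_eq [DecidableEq K] (S : Series σ K) {s : State σ K} (hr : s.r = S.r) {o : ℕ}
    (ho : S.F.order = o) (hos : ordZero s.F = o) : (PointBlowup.step q j b s).r = (S.step q j b).r := by
  show PointBlowup.newMult q j b s = S.newMult q j b
  unfold PointBlowup.newMult newMult
  rw [hr, ho, hos, ENat.toNat_coe]

end Defs

end Series

/-! ## §5 Transfer along one step -/

/-- **TRANSFER OF ONE STEP.**  If `s` agrees with `S` below `M` and the order `o` of `S` is `< M`, then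
`step q j b s` agrees with `S.step q j b` below `M − q` (`b_j = 0`). [folklore] -/
theorem Agree.step [Fintype σ] [DecidableEq σ] [DecidableEq K] (q : ℕ) (j : σ) (b : σ → K) (hbj : b j = 0) {M : ℕ} {s : State σ K} {S : Series σ K}
    (h : Agree M s S) {o : ℕ} (ho : S.F.order = o) (hoM : o < M) :
    Agree (M - q) (PointBlowup.step q j b s) (S.step q j b) := by
  refine ⟨fun E hE => ?_, S.step_r_eq_of_ordZero_eq h.2 ho (h.ordZero_eq ho hoM)⟩
  symm
  refine S.coeff_step_F hbj E fun d hd => h.1 d ?_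
  have := Finsupp.le_degree j E
  omega

/-- **TRANSFER OF EQUIMULTIPLICITY.**  Under agreement below `M ≥ 2q` (`b_j = 0`), the point is equimultiple for
the polynomial state iff it is for the series state. [folklore] -/
theorem Agree.isEquimultiplePoint_iff [Fintype σ] [DecidableEq σ] (q : ℕ) (j : σ) (b : σ → K) (hbj : b j = 0) {M : ℕ} {s : State σ K}
    {S : Series σ K} (h : Agree M s S) (hM : 2 * q ≤ M) :
    IsEquimultiplePoint q j b s ↔ S.IsEquimultiplePoint q j b := by
  have key : ∀ d : σ →₀ ℕ, d.degree < q →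
      MvPowerSeries.coeff d (S.pointTransform q j b) = coeff d (pointTransform q j b s) := by
    intro d hd
    refine S.coeff_pointTransform hbj d fun d' hd' => (h.1 d' ?_)
    have := Finsupp.le_degree j d
    omega
  refine ⟨fun hs d hd0 hd => ?_, fun hS d hd0 hd => ?_⟩
  · rw [key d hd]; exact hs d hd0 hd
  · rw [← key d hd]; exact hS d hd0 hd

/-! ## §6 Cleanedness and divisibility for series -/

/-- A power series is **cleaned**: it has no `p`-th power monomial (`deletePthPowers` for series, as a predicate).
[folklore] -/
def IsClean (p : ℕ) (φ : MvPowerSeries σ K) : Prop :=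
  ∀ d : σ →₀ ℕ, IsPthPowerExponent p d → MvPowerSeries.coeff d φ = 0

/-- The exceptional monomial **divides** the series: `y^r ∣ F` coefficientwise. [folklore] -/
def Divides (r : σ →₀ ℕ) (φ : MvPowerSeries σ K) : Prop :=
  ∀ d : σ →₀ ℕ, MvPowerSeries.coeff d φ ≠ 0 → r ≤ d

/-- The residual series after a step is cleaned. [folklore] -/
theorem Series.isClean_step [Fintype σ] [DecidableEq σ] [DecidableEq K] (q : ℕ) (j : σ) (b : σ → K) (S : Series σ K) : IsClean q (S.step q j b).F := by
  intro d hd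
  rw [MvPowerSeries.coeff_apply]
  show coeff d (deletePthPowers q _) = 0
  rw [coeff_deletePthPowers, if_pos hd]

/-- The truncation of a cleaned series is a cleaned polynomial. [folklore] -/
theorem IsClean.deletePthPowers_truncTot [Fintype σ] [DecidableEq σ] {p : ℕ} {φ : MvPowerSeries σ K} (h : IsClean p φ) (N : ℕ) :
    deletePthPowers p (truncTot N φ) = truncTot N φ := by
  ext d
  rw [coeff_deletePthPowers]
  split_ifs with hd
  · rw [coeff_truncTot]
    split_ifs
    · exact (h d hd).symm
    · rfl
  · rfl

/-- The truncation of a series divisible by `y^r` is divisible by `y^r`. [folklore] -/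
theorem Divides.truncTot [Fintype σ] [DecidableEq σ] {r : σ →₀ ℕ} {φ : MvPowerSeries σ K} (h : Divides r φ) (N : ℕ) :
    ∀ d ∈ (truncTot N φ).support, r ≤ d := by
  intro d hd
  rw [MvPolynomial.mem_support_iff, coeff_truncTot] at hd
  split_ifs at hd with hlt
  · exact h d hd
  · exact absurd rfl hd

/-- Under agreement below `M`, a monomial of degree `< M` of the polynomial is divisible by `y^r` if the series
is. [folklore] -/
theorem Agree.le_of_mem_support {M : ℕ} {s : State σ K} {S : Series σ K} (h : Agree M s S)
    (hdiv : Divides S.r S.F) {e : σ →₀ ℕ} (he : e ∈ s.F.support) (heM : e.degree < M) : s.r ≤ e := by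
  rw [h.2]
  exact hdiv e ((h.mem_support_iff heM).mp he)

/-- **Divisibility propagates along the series step**: if `y^r ∣ F` (series of order `o`) then `y^{r'} ∣ F'`
(`b_j = 0`). [folklore] -/
theorem Series.divides_step [Fintype σ] [DecidableEq σ] [DecidableEq K] (q : ℕ) (j : σ) (b : σ → K) (hbj : b j = 0) (S : Series σ K) {o : ℕ}
    (ho : S.F.order = o) (hdiv : Divides S.r S.F) : Divides (S.step q j b).r (S.step q j b).F := by
  intro E hE
  -- read the step on the truncation below `E.degree + q + 1 > o`? use `N := max (E.degree + q + 1) (o + 1)`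
  set N := max (E.degree + q + 1) (o + 1) with hN
  have hagree : Agree N (S.trunc N) S := agree_trunc N S
  have hstep := hagree.step q j b hbj ho (by omega)
  have hEN : E.degree < N - q := by omega
  rw [← hstep.2]
  refine newMult_le_of_mem_support_step q j b hbj (S.trunc N) (hagree.ordZero_eq ho (by omega))
    (hdiv.truncTot N) E ?_
  exact (hstep.mem_support_iff hEN).mpr hE

end Summit.ResolutionOfSingularities.ResolutionOfSingularities.Theorems.CampaignW46.MohWindowShadePS
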